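import Summits.Ventures.CertifiedArithmetic.LowPrec.SRRecursionVariance
import Summits.Ventures.CertifiedArithmetic.LowPrec.SRLimitedBitsMSEGeneral
import Summits.Ventures.CertifiedArithmetic.LowPrec.SRTreeLimitedBits
import HarnessLib

/-!
# Affine recursions under LIMITED-RANDOMNESS stochastic rounding, I — the model and the bias law

HONEST FRAMING: certified error envelopes and provably optimal rounding/accumulation schemes for
low-precision formats under stated cost models; every table by two implementations; no hardware or
vendor claims.

Files XLVI–XLVIII (`SRRecursion*`) treat recursions `xₖ₊₁ = SR_F(a k · xₖ + b k)` (EMA / momentum /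
axpy / product chains / Horner) under EXACT saturating SR into a finite value set `F`: no saturation ⇒
`E[xₙ] = mₙ` (the exact trajectory) and `Var[xₙ] = ∑ₖ A_{k+1}² E[v_F] ≤ (∑ₖ A_{k+1}²)·G²/4`. Files
XIX/LXI/LXX treat SUMS under limited-randomness SR (a perturbed away-probability `q(θ)`, `q : [0,1] →
[0,1]`, `|q θ − θ| ≤ ε`: IEEE P3109 StochasticA `ε = 2^{-N}`, B/C `ε = 2^{-(N+1)}`, `SR_ε`, exact SR
`ε = 0`). This file is the missing cell of the matrix: RECURSIONS × LIMITED RANDOMNESS.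

* `LimitedBits.recExpQ F q g n f s = E[f(xₙ)]`, `x₀ = s`, `xₖ₊₁ = round_q(g k xₖ)` — the backward
  recursion with the perturbed step `stepQ` of file XIX; `accExpQ` (sums) is the case `g k t = t + x k`
  (`accExpQ_eq_recExpQ`) and exact probabilities give back `recExp` (`recExpQ_of_id`); linear, monotone
  through the two leaves, `E[1] = 1`.
* `absGainSum a n = ∑ₖ |A_{k+1}|`, `A_{k+1} = ∏_{j>k} a j` the DOWNSTREAM GAIN of step `k` — the bias
  weight (companion of the variance weight `sqGainSum a n = ∑ₖ A_{k+1}²` of file XLVII), with the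
  envelopes `absGainSum ≤ n` for `|a k| ≤ 1` and `≤ 1/(1 − β)` for contractions `|a k| ≤ β < 1`.
* **`abs_recExpQ_affMap_id_sub_le` — THE BIAS LAW.** If `q([0,1]) ⊆ [0,1]`, `|q θ − θ| ≤ ε`, no branch
  saturates and every candidate gap on every branch is `≤ G`, then
  `|E[xₙ] − mₙ| ≤ (∑ₖ |A_{k+1}|)·ε·G`:
  each step's conditional bias `|βₖ| ≤ ε·gapₖ` (file XIX) is PROPAGATED by the downstream gain, exactly
  as the conditional variances are propagated by the squared gains. Sums (`a ≡ 1`): `n·ε·G` (file XIX);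
  contractions `|a k| ≤ β < 1` (EMA, momentum): `≤ ε·G/(1−β)` UNIFORMLY IN TIME
  (`abs_recExpQ_affMap_id_sub_le_stationary`) — limited randomness re-introduces a bias floor of the
  order of the RN dead band times `ε`, never a dead band; expansions are weighted by the growing gains.
* Instances: `SR_ε` (`srEps_rec_bias_le`), P3109 StochasticA/B/C with `N` random bits
  (`stochasticA/B/C_rec_bias_le`).

Second moments (martingale + drift decomposition, RMS triangle law with the two gain sums) are file
LXXIV (`SRRecursionLimitedBitsMSE`); Horner / FMA-Horner polynomial evaluation with kernel-checked FP4
witnesses is file LXXV (`SRHornerLimitedBits`).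

Placement. [ElararEtAl2025] (= El Arar–Fasi–Filip–Mikaitis, arXiv:2603.24161, Thm. 1) bound Horner
under `SR_{p,r}` in the `(1+δ)` model to first order with probability `1 − λ`; the statements here are
exact finite-format expectation bounds for every admissible `q`, with saturation excluded by hypothesis
only and subnormals allowed (they only change `G`).
-/

namespace Summit.Ventures.CertifiedArithmetic.LowPrec.SR

open Literature.ComputerArithmetic.ConnollyHighamMary2021
open Finset

variable {K : Type*} [Field K] [LinearOrder K] [IsStrictOrderedRing K]

namespace LimitedBits

/-! ### The model: recursions with perturbed steps -/

/-- `recExpQ F q g n f s = E[f(xₙ)]` for `x₀ = s`, `xₖ₊₁ = round_q(g k xₖ)`: saturating rounding into `F`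
whose away-from-zero probability is `q(θ)`, `θ` the exact-SR away-probability (backward recursion). -/
def recExpQ (F : Finset K) (q : K → K) : (ℕ → K → K) → ℕ → (K → K) → K → K
  | _, 0, f, s => f s
  | g, n + 1, f, s => stepQ F q (g 0 s) (recExpQ F q (fun i => g (i + 1)) n f)

omit [IsStrictOrderedRing K] in
/-- Recursive summation with perturbed steps (file XIX) is the recursion with maps `t ↦ t + x k`. -/
theorem accExpQ_eq_recExpQ (F : Finset K) (q : K → K) (x : ℕ → K) (n : ℕ) (f : K → K) (s : K) :
    accExpQ F q x n f s = recExpQ F q (fun k t => t + x k) n f s := by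
  induction n generalizing x s with
  | zero => rfl
  | succ n ih =>
      simp only [accExpQ, recExpQ]
      congr 1; funext t; exact ih _ t

omit [IsStrictOrderedRing K] in
/-- Exact probabilities (`q = id`) give the exact-SR recursion model `recExp` of file XLVI. -/
theorem recExpQ_of_id (F : Finset K) {q : K → K} (hq : ∀ η, q η = η) (g : ℕ → K → K) (n : ℕ)
    (f : K → K) (s : K) : recExpQ F q g n f s = recExp F g n f s := by
  induction n generalizing g s with
  | zero => rfl
  | succ n ih =>
      simp only [recExpQ, recExp]
      rw [stepQ_of_id F hq]
      congr 1; funext t; exact ih _ t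

omit [IsStrictOrderedRing K] in
/-- Constants are preserved. -/
theorem recExpQ_const (F : Finset K) (q : K → K) (g : ℕ → K → K) (n : ℕ) (a s : K) :
    recExpQ F q g n (fun _ => a) s = a := by
  induction n generalizing g s with
  | zero => rfl
  | succ n ih =>
      simp only [recExpQ]
      have : recExpQ F q (fun i => g (i + 1)) n (fun _ => a) = fun _ => a := funext fun t => ih _ t
      rw [this, stepQ_const]

omit [IsStrictOrderedRing K] in
/-- Linearity in the test function. -/
theorem recExpQ_lin (F : Finset K) (q : K → K) (g : ℕ → K → K) (n : ℕ) (a b : K) (f h : K → K)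
    (s : K) : recExpQ F q g n (fun t => a * f t + b * h t) s
      = a * recExpQ F q g n f s + b * recExpQ F q g n h s := by
  induction n generalizing g s with
  | zero => rfl
  | succ n ih =>
      simp only [recExpQ]
      have : recExpQ F q (fun i => g (i + 1)) n (fun t => a * f t + b * h t)
          = fun t => a * recExpQ F q (fun i => g (i + 1)) n f t
            + b * recExpQ F q (fun i => g (i + 1)) n h t := funext fun t => ih _ t
      rw [this]; unfold stepQ; ring

/-- Monotonicity in the test function (`q([0,1]) ⊆ [0,1]`). -/
theorem recExpQ_mono (F : Finset K) {q : K → K} (hq01 : ∀ η, 0 ≤ η → η ≤ 1 → 0 ≤ q η ∧ q η ≤ 1)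
    (g : ℕ → K → K) (n : ℕ) {f h : K → K} (hfh : ∀ t, f t ≤ h t) (s : K) :
    recExpQ F q g n f s ≤ recExpQ F q g n h s := by
  induction n generalizing g s with
  | zero => exact hfh s
  | succ n ih =>
      simp only [recExpQ]
      exact stepQ_mono_leaves F hq01 _ (ih _ _) (ih _ _)

/-- `|E f| ≤ M` when `|f| ≤ M` at the two leaves of a perturbed step. -/
theorem abs_stepQ_le_of_leaves (F : Finset K) {q : K → K}
    (hq01 : ∀ η, 0 ≤ η → η ≤ 1 → 0 ≤ q η ∧ q η ≤ 1) (c : K) {f : K → K} {M : K}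
    (hu : |f (up F c)| ≤ M) (hd : |f (dn F c)| ≤ M) : |stepQ F q c f| ≤ M := by
  rw [abs_le]
  constructor
  · have := stepQ_mono_leaves F hq01 c (f := fun _ => -M) (g := f) (abs_le.mp hu).1 (abs_le.mp hd).1
    rwa [stepQ_const] at this
  · have := stepQ_mono_leaves F hq01 c (f := f) (g := fun _ => M) (abs_le.mp hu).2 (abs_le.mp hd).2
    rwa [stepQ_const] at this

/-! ### The bias weight: sum of absolute downstream gains -/

/-- `absGainSum a n = ∑_{k<n} |∏_{k<j<n} a j|` — the bias weight (peeling index `0` first). -/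
def absGainSum (a : ℕ → K) : ℕ → K
  | 0 => 0
  | n + 1 => |affGain (fun i => a (i + 1)) n| + absGainSum (fun i => a (i + 1)) n

/-- The bias weight is nonnegative. -/
theorem absGainSum_nonneg (a : ℕ → K) (n : ℕ) : 0 ≤ absGainSum a n := by
  induction n generalizing a with
  | zero => exact le_rfl
  | succ n ih => exact add_nonneg (abs_nonneg _) (ih _)

/-- Gain of a chain with `|a k| ≤ β`: `|∏_{k<n} a k| ≤ βⁿ`. -/
theorem abs_affGain_le (a : ℕ → K) {β : K} (hβ : ∀ k, |a k| ≤ β) (n : ℕ) :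
    |affGain a n| ≤ β ^ n := by
  have hβ0 : 0 ≤ β := (abs_nonneg _).trans (hβ 0)
  induction n generalizing a with
  | zero => simp [affGain]
  | succ n ih =>
      simp only [affGain, abs_mul, pow_succ]
      exact mul_le_mul (ih _ (fun k => hβ (k + 1))) (hβ 0) (abs_nonneg _)
        (pow_nonneg hβ0 n)

/-- `|a k| ≤ β ⇒ absGainSum a n ≤ ∑_{k<n} βᵏ`. -/
theorem absGainSum_le_geomSum (a : ℕ → K) {β : K} (hβ : ∀ k, |a k| ≤ β) (n : ℕ) :
    absGainSum a n ≤ ∑ k ∈ range n, β ^ k := by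
  induction n generalizing a with
  | zero => simp [absGainSum]
  | succ n ih =>
      simp only [absGainSum]
      rw [Finset.sum_range_succ]
      have h1 := abs_affGain_le (fun i => a (i + 1)) (fun k => hβ (k + 1)) n
      have h2 := ih (fun i => a (i + 1)) (fun k => hβ (k + 1))
      linarith

/-- Non-expanding maps (`|a k| ≤ 1`: sums, axpy, EMA, momentum, Horner with `|t| ≤ 1`):
`absGainSum a n ≤ n`. -/
theorem absGainSum_le_of_le_one (a : ℕ → K) (h1 : ∀ k, |a k| ≤ 1) (n : ℕ) : absGainSum a n ≤ n := by
  refine (absGainSum_le_geomSum a h1 n).trans ?_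
  simp

/-- Contractions (`|a k| ≤ β < 1`): `absGainSum a n ≤ (1 − βⁿ)/(1 − β) ≤ 1/(1 − β)` for every `n`. -/
theorem absGainSum_le_stationary (a : ℕ → K) {β : K} (hβ : ∀ k, |a k| ≤ β) (hβ1 : β < 1) (n : ℕ) :
    absGainSum a n ≤ 1 / (1 - β) := by
  have hβ0 : 0 ≤ β := (abs_nonneg _).trans (hβ 0)
  refine (absGainSum_le_geomSum a hβ n).trans ?_
  rw [le_div_iff₀ (sub_pos.mpr hβ1), geom_sum_mul_neg]
  linarith [pow_nonneg hβ0 n]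

/-- Sums / axpy (`a ≡ 1`): `absGainSum = n`. -/
theorem absGainSum_one (n : ℕ) : absGainSum (fun _ => (1 : K)) n = n := by
  induction n with
  | zero => simp [absGainSum]
  | succ n ih =>
      simp only [absGainSum]
      have hg : ∀ m, affGain (fun _ => (1 : K)) m = 1 := by
        intro m; induction m with
        | zero => rfl
        | succ m ihm => simp only [affGain, mul_one]; exact ihm
      have : (fun i : ℕ => (1 : K)) = fun _ => 1 := rfl
      rw [hg, ih]; push_cast; rw [abs_one]; ring

/-! ### The bias law -/

/-- **Bias of affine recursions under limited-randomness SR.** If `q` maps `[0,1]` into `[0,1]` with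
`|q θ − θ| ≤ ε`, no branch saturates and every candidate gap on every branch is `≤ G`, then
`|E[xₙ] − mₙ| ≤ (∑ₖ |A_{k+1}|)·ε·G` — the conditional biases `|βₖ| ≤ ε·gapₖ` propagated by the
downstream gains. (`ε = 0`, exact SR: `E[xₙ] = mₙ`, file XLVI.) -/
theorem abs_recExpQ_affMap_id_sub_le (F : Finset K) {q : K → K} {ε G : K}
    (hq01 : ∀ η, 0 ≤ η → η ≤ 1 → 0 ≤ q η ∧ q η ≤ 1) (hq : ∀ η, 0 ≤ η → η ≤ 1 → |q η - η| ≤ ε) :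
    ∀ (a b : ℕ → K) (n : ℕ) (s : K), NoSatR F (affMap a b) n s → GapLER F G (affMap a b) n s →
      |recExpQ F q (affMap a b) n (fun t => t) s - affMean a b n s| ≤ absGainSum a n * (ε * G) := by
  have hε : 0 ≤ ε := (abs_nonneg _).trans (hq 0 le_rfl zero_le_one)
  intro a b n
  induction n generalizing a b with
  | zero => intro s _ _; simp [recExpQ, affMean, absGainSum]
  | succ n ih =>
      rintro s ⟨hc, hu, hd⟩ ⟨hg, hgu, hgd⟩
      simp only [affMap_succ, affMap_apply] at hc hu hd hg hgu hgd
      simp only [recExpQ, affMap_succ, affMean, absGainSum, affMap_apply]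
      set c := a 0 * s + b 0 with hcdef
      set a' : ℕ → K := fun i => a (i + 1) with ha'
      set b' : ℕ → K := fun i => b (i + 1) with hb'
      set A₁ := affGain a' n with hA₁
      -- inner expectation = affine part + remainder bounded at the two leaves
      set r : K → K := fun t => recExpQ F q (affMap a' b') n (fun t => t) t - affMean a' b' n t with hr
      have hru : |r (up F c)| ≤ absGainSum a' n * (ε * G) := ih a' b' (up F c) hu hgu
      have hrd : |r (dn F c)| ≤ absGainSum a' n * (ε * G) := ih a' b' (dn F c) hd hgd
      have hsplit : recExpQ F q (affMap a' b') n (fun t => t)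
          = fun t => A₁ * t + (1 : K) * (affMean a' b' n 0 + r t) := by
        funext t; simp only [hr]; rw [affMean_eq a' b' n t]; ring
      rw [hsplit, show (fun t => A₁ * t + (1 : K) * (affMean a' b' n 0 + r t))
          = fun t => A₁ * (fun t => t) t + 1 * (fun t => affMean a' b' n 0 + r t) t from rfl]
      rw [show stepQ F q c (fun t => A₁ * (fun t => t) t + 1 * (fun t => affMean a' b' n 0 + r t) t)
          = A₁ * stepQ F q c (fun t => t) + 1 * stepQ F q c (fun t => affMean a' b' n 0 + r t) by
            unfold stepQ; ring]
      rw [stepQ_add, stepQ_const, affMean_eq a' b' n c]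
      have h1 : |stepQ F q c (fun t => t) - c| ≤ ε * G := by
        have := abs_stepQ_id_sub_le F hq c
        rw [clamp_eq_self hc] at this
        exact this.trans (mul_le_mul_of_nonneg_left hg hε)
      have h2 : |stepQ F q c r| ≤ absGainSum a' n * (ε * G) := abs_stepQ_le_of_leaves F hq01 c hru hrd
      calc |A₁ * stepQ F q c (fun t => t) + 1 * (affMean a' b' n 0 + stepQ F q c r)
              - (A₁ * c + affMean a' b' n 0)|
          = |A₁ * (stepQ F q c (fun t => t) - c) + stepQ F q c r| := by ring_nf
        _ ≤ |A₁ * (stepQ F q c (fun t => t) - c)| + |stepQ F q c r| := abs_add_le _ _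
        _ ≤ |A₁| * (ε * G) + absGainSum a' n * (ε * G) := by
            rw [abs_mul]; exact add_le_add (mul_le_mul_of_nonneg_left h1 (abs_nonneg _)) h2
        _ = (|A₁| + absGainSum a' n) * (ε * G) := by ring

/-- **Non-expanding maps** (`|a k| ≤ 1`): `|E[xₙ] − mₙ| ≤ n·ε·G` — the file-XIX sum bound holds
verbatim for axpy, EMA, momentum and Horner with `|t| ≤ 1`. -/
theorem abs_recExpQ_affMap_id_sub_le_of_le_one (F : Finset K) {q : K → K} {ε G : K}
    (hq01 : ∀ η, 0 ≤ η → η ≤ 1 → 0 ≤ q η ∧ q η ≤ 1) (hq : ∀ η, 0 ≤ η → η ≤ 1 → |q η - η| ≤ ε)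
    (hG : 0 ≤ G) (a b : ℕ → K) (h1 : ∀ k, |a k| ≤ 1) (n : ℕ) (s : K)
    (hns : NoSatR F (affMap a b) n s) (hgap : GapLER F G (affMap a b) n s) :
    |recExpQ F q (affMap a b) n (fun t => t) s - affMean a b n s| ≤ n * (ε * G) := by
  have hε : 0 ≤ ε := (abs_nonneg _).trans (hq 0 le_rfl zero_le_one)
  exact (abs_recExpQ_affMap_id_sub_le F hq01 hq a b n s hns hgap).trans
    (mul_le_mul_of_nonneg_right (absGainSum_le_of_le_one a h1 n) (mul_nonneg hε hG))

/-- **Contractions, uniformly in time** (`|a k| ≤ β < 1`: EMA `β`, momentum): `|E[xₙ] − mₙ| ≤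
ε·G/(1 − β)` for EVERY `n` — a bias FLOOR of size `ε ×` (the RN dead-band scale `G/(1−β)`), no dead
band. -/
theorem abs_recExpQ_affMap_id_sub_le_stationary (F : Finset K) {q : K → K} {ε G : K}
    (hq01 : ∀ η, 0 ≤ η → η ≤ 1 → 0 ≤ q η ∧ q η ≤ 1) (hq : ∀ η, 0 ≤ η → η ≤ 1 → |q η - η| ≤ ε)
    (hG : 0 ≤ G) (a b : ℕ → K) {β : K} (hβ : ∀ k, |a k| ≤ β) (hβ1 : β < 1) (n : ℕ) (s : K)
    (hns : NoSatR F (affMap a b) n s) (hgap : GapLER F G (affMap a b) n s) :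
    |recExpQ F q (affMap a b) n (fun t => t) s - affMean a b n s| ≤ ε * G / (1 - β) := by
  have hε : 0 ≤ ε := (abs_nonneg _).trans (hq 0 le_rfl zero_le_one)
  have h := (abs_recExpQ_affMap_id_sub_le F hq01 hq a b n s hns hgap).trans
    (mul_le_mul_of_nonneg_right (absGainSum_le_stationary a hβ hβ1 n) (mul_nonneg hε hG))
  calc _ ≤ 1 / (1 - β) * (ε * G) := h
    _ = ε * G / (1 - β) := by ring

end LimitedBits

/-! ### Instances: `SR_ε` and the three P3109 rules -/

/-- `SR_ε` of [XiaEtAl2022]: `|E[xₙ] − mₙ| ≤ (∑ₖ |A_{k+1}|)·ε·G`. -/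
theorem srEps_rec_bias_le (F : Finset K) {ε G : K} (hε : 0 ≤ ε) (a b : ℕ → K) (n : ℕ) (s : K)
    (hns : NoSatR F (affMap a b) n s) (hgap : GapLER F G (affMap a b) n s) :
    |LimitedBits.recExpQ F (qAway ε) (affMap a b) n (fun t => t) s - affMean a b n s|
      ≤ LimitedBits.absGainSum a n * (ε * G) :=
  LimitedBits.abs_recExpQ_affMap_id_sub_le F (qAway_mem hε) (qAway_dev hε) a b n s hns hgap

section P3109
variable [FloorRing K]

/-- **P3109 StochasticA, `N` random bits**: `|E[xₙ] − mₙ| ≤ (∑ₖ |A_{k+1}|)·2^{-N}·G`. -/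
theorem stochasticA_rec_bias_le (F : Finset K) (N : ℕ) {G : K} (a b : ℕ → K) (n : ℕ) (s : K)
    (hns : NoSatR F (affMap a b) n s) (hgap : GapLER F G (affMap a b) n s) :
    |LimitedBits.recExpQ F (LimitedBits.probAwayA N) (affMap a b) n (fun t => t) s - affMean a b n s|
      ≤ LimitedBits.absGainSum a n * (1 / 2 ^ N * G) :=
  LimitedBits.abs_recExpQ_affMap_id_sub_le F (LimitedBits.probAwayA_mem N)
    (fun η _ _ => LimitedBits.abs_probAwayA_sub_le N η) a b n s hns hgap

/-- **P3109 StochasticB, `N` random bits**: `|E[xₙ] − mₙ| ≤ (∑ₖ |A_{k+1}|)·2^{-(N+1)}·G`. -/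
theorem stochasticB_rec_bias_le (F : Finset K) (N : ℕ) {G : K} (a b : ℕ → K) (n : ℕ) (s : K)
    (hns : NoSatR F (affMap a b) n s) (hgap : GapLER F G (affMap a b) n s) :
    |LimitedBits.recExpQ F (LimitedBits.probAwayB N) (affMap a b) n (fun t => t) s - affMean a b n s|
      ≤ LimitedBits.absGainSum a n * (1 / 2 ^ (N + 1) * G) :=
  LimitedBits.abs_recExpQ_affMap_id_sub_le F (LimitedBits.probAwayB_mem N)
    (fun η _ _ => LimitedBits.abs_probAwayB_sub_le N η) a b n s hns hgap

/-- **P3109 StochasticC, `N` random bits**: `|E[xₙ] − mₙ| ≤ (∑ₖ |A_{k+1}|)·2^{-(N+1)}·G`. -/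
theorem stochasticC_rec_bias_le (F : Finset K) (N : ℕ) {G : K} (a b : ℕ → K) (n : ℕ) (s : K)
    (hns : NoSatR F (affMap a b) n s) (hgap : GapLER F G (affMap a b) n s) :
    |LimitedBits.recExpQ F (LimitedBits.probAwayC N) (affMap a b) n (fun t => t) s - affMean a b n s|
      ≤ LimitedBits.absGainSum a n * (1 / 2 ^ (N + 1) * G) :=
  LimitedBits.abs_recExpQ_affMap_id_sub_le F (LimitedBits.probAwayC_mem N)
    (fun η _ _ => LimitedBits.abs_probAwayC_sub_le N η) a b n s hns hgap

end P3109

end Summit.Ventures.CertifiedArithmetic.LowPrec.SR
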